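import Summits.ValiantsHypothesis.ValiantsHypothesis.Theorems.BarrierLeverTransversalMinorLayoutsEightFaces

/-!
# Route BarrierLever — item `TransversalLayoutsRankLeEight` (stmt-ValiantsHypothesis-19933):
# eight faces without a vertex of degree one, part 1 — the frame of the graph case

Helper file (`--supports stmt-ValiantsHypothesis-19933`; cell valiant-natproofs, rung V4, 𝒟-side of
door (c); seat val-np-p1 gen 8).  `eight_no_degree_one_frame`: in a lower family of
exactly eight sets of size `≤ 2` in which no element lies in exactly one member, fix a pair member
`{a, b}`; the four members outside its subsets are two singletons `{c}, {d}` (`c, d ∉ {a, b}`) and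
two pairs `y ≠ z` inside `{a, b, c, d}`, each through `c` or `d`, together covering `c` and `d`
(outside singletons need outside pairs and conversely; one or three outside singletons are
impossible by counting).  The companion `…EightFacesNoDegOne` turns the frame into the
classification solid triangle / four-path / three-star.

WHAT THIS IS NOT: bookkeeping for a bounded-rank slice of TT; nothing on TT / item 19761 in
general, on crux stmt-ValiantsHypothesis-14610, or on `VP` versus `VNP`.
-/

-- layout Summits/ValiantsHypothesis/ValiantsHypothesis forces the duplicated namespace component
set_option linter.dupNamespace false

open Matrix Finset

namespace Summit.ValiantsHypothesis.ValiantsHypothesis.Theorems.BarrierLever.FiniteCheck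

open Summit.ValiantsHypothesis.ValiantsHypothesis.Theorems.BarrierLever.Compression

/-- GRAPH CASE FRAME for eight faces without a degree-one element: a pair member `{a, b}`,
two outside singletons `{c}, {d}` and two outside pairs `y, z` inside `{a, b, c, d}` through `c`
or `d`, exhausting the family. -/
theorem eight_no_degree_one_frame {h : ℕ} (F : Finset (Finset (Fin h)))
    (hlow : ∀ x ∈ F, ∀ t, t ⊆ x → t ∈ F) (hF : F.card = 8)
    (hdeg : ∀ c : Fin h, (F.filter fun x => c ∈ x).card ≠ 1) (hle2 : ∀ x ∈ F, x.card ≤ 2) :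
    ∃ (a b c d : Fin h) (y z : Finset (Fin h)), a ≠ b ∧ c ≠ a ∧ c ≠ b ∧ d ≠ a ∧ d ≠ b ∧ c ≠ d ∧
      y ≠ z ∧ ({a} : Finset (Fin h)) ∈ F ∧ ({b} : Finset (Fin h)) ∈ F ∧
      ({a, b} : Finset (Fin h)) ∈ F ∧ ({c} : Finset (Fin h)) ∈ F ∧ ({d} : Finset (Fin h)) ∈ F ∧
      y ∈ F ∧ z ∈ F ∧
      (∀ t, t ∈ F → t = ∅ ∨ t = {a} ∨ t = {b} ∨ t = {a, b} ∨ t = {c} ∨ t = {d} ∨ t = y ∨ t = z) ∧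
      (∀ t, (t = y ∨ t = z) → ∀ e₀ ∈ t, ∃ g : Fin h, g ≠ e₀ ∧ t = {e₀, g} ∧
        (g = a ∨ g = b ∨ g = c ∨ g = d)) ∧
      (∀ t, (t = y ∨ t = z) → ∃ e f : Fin h, e ≠ f ∧ t = {e, f} ∧ (e = c ∨ e = d) ∧
        (f = a ∨ f = b ∨ f = c ∨ f = d)) ∧
      (∀ e : Fin h, (e = c ∨ e = d) → e ∈ y ∨ e ∈ z) := by
  classical
  obtain ⟨hpairOf, x, hxF, hx2⟩ := exists_pair_of_no_degree_one' F hlow hle2 (by omega) hdeg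
  obtain ⟨a, b, hab, rfl⟩ := Finset.card_eq_two.mp hx2
  obtain ⟨hPF, hPcard, hsing⟩ := pair_frame F hlow a b hab hxF
  set P : Finset (Finset (Fin h)) := {∅, {a}, {b}, {a, b}} with hPdef
  have hPmem : ∀ y, y ∈ P ↔ y = ∅ ∨ y = {a} ∨ y = {b} ∨ y = {a, b} := by
    intro y; simp only [hPdef, Finset.mem_insert, Finset.mem_singleton]
  have haF : ({a} : Finset (Fin h)) ∈ F := hPF (by rw [hPmem]; simp)
  have hbF : ({b} : Finset (Fin h)) ∈ F := hPF (by rw [hPmem]; simp)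
  have hdiff : (F \ P).card = 4 := by rw [Finset.card_sdiff_of_subset hPF, hF, hPcard]
  -- outsiders: singletons {c} (c ∉ {a,b}) or pairs
  have hout : ∀ y, y ∈ F → y ∉ P → (∃ c, y = {c} ∧ c ≠ a ∧ c ≠ b) ∨ y.card = 2 := by
    intro y hyF hyP
    have hy2 := hle2 y hyF
    rcases Nat.lt_or_ge y.card 2 with hlt | hge
    · left
      rcases Nat.lt_or_ge y.card 1 with h0 | h1
      · exfalso; apply hyP
        rw [Finset.card_eq_zero.mp (show y.card = 0 by omega), hPdef]; simp
      · obtain ⟨c, rfl⟩ := Finset.card_eq_one.mp (show y.card = 1 by omega)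
        refine ⟨c, rfl, fun e => hyP ?_, fun e => hyP ?_⟩
        · rw [e, hPdef]; simp
        · rw [e, hPdef]; simp
    · exact Or.inr (le_antisymm hy2 hge)
  have hsing_out : ∀ c : Fin h, ({c} : Finset (Fin h)) ∈ F → c ≠ a → c ≠ b →
      ∃ y, y ∈ F ∧ y ∉ P ∧ y.card = 2 ∧ c ∈ y := by
    intro c hc hca hcb
    obtain ⟨y, hyF, hcy, hy2⟩ := hpairOf c hc
    refine ⟨y, hyF, fun hyP => ?_, hy2, hcy⟩
    rw [hPmem] at hyP
    rcases hyP with rfl | rfl | rfl | rfl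
    · simp at hcy
    · simp at hy2
    · simp at hy2
    · simp only [Finset.mem_insert, Finset.mem_singleton] at hcy
      rcases hcy with e | e
      · exact hca e
      · exact hcb e
  have hsingP : ∀ c : Fin h, c ≠ a → c ≠ b → ({c} : Finset (Fin h)) ∉ P := by
    intro c hca hcb hP
    rcases hsing c hP with e | e
    · exact hca e
    · exact hcb e
  -- elements of an outside pair: a, b, or an outside singleton
  have helem : ∀ y, y ∈ F → ∀ e ∈ y, e = a ∨ e = b ∨
      (({e} : Finset (Fin h)) ∈ F ∧ ({e} : Finset (Fin h)) ∉ P) := by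
    intro y hyF e he
    have heF : ({e} : Finset (Fin h)) ∈ F := hlow y hyF _ (Finset.singleton_subset_iff.mpr he)
    by_cases heP : ({e} : Finset (Fin h)) ∈ P
    · rcases hsing e heP with h' | h'
      · exact Or.inl h'
      · exact Or.inr (Or.inl h')
    · exact Or.inr (Or.inr ⟨heF, heP⟩)
  have hpair_out : ∀ y, y ∈ F → y ∉ P → y.card = 2 →
      ∃ c ∈ y, ({c} : Finset (Fin h)) ∈ F ∧ ({c} : Finset (Fin h)) ∉ P := by
    intro y hyF hyP hy2
    by_contra hno
    push Not at hno
    apply hyP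
    have hsub : y ⊆ {a, b} := by
      intro c hc
      rcases helem y hyF c hc with rfl | rfl | ⟨hcF, hcP⟩
      · simp
      · simp
      · exact absurd (hno c hc hcF) hcP
    rw [Finset.eq_of_subset_of_card_le hsub (by rw [Finset.card_pair hab, hy2]), hPdef]
    simp
  -- the outside singletons: at least one, at most two, not exactly one ⇒ exactly two
  set Sg : Finset (Finset (Fin h)) := (F \ P).filter fun t => t.card = 1 with hSgdef
  have hSg_mem : ∀ t, t ∈ Sg ↔ ∃ c, t = {c} ∧ ({c} : Finset (Fin h)) ∈ F ∧ c ≠ a ∧ c ≠ b := by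
    intro t
    rw [hSgdef, Finset.mem_filter, Finset.mem_sdiff]
    constructor
    · rintro ⟨⟨htF, htP⟩, ht1⟩
      obtain ⟨c, rfl⟩ := Finset.card_eq_one.mp ht1
      rcases hout {c} htF htP with ⟨c', hc', hca, hcb⟩ | h2
      · have : c = c' := Finset.singleton_injective hc'
        subst this
        exact ⟨c, rfl, htF, hca, hcb⟩
      · simp at h2
    · rintro ⟨c, rfl, hcF, hca, hcb⟩
      exact ⟨⟨hcF, hsingP c hca hcb⟩, Finset.card_singleton c⟩
  -- Sg has exactly two members
  have hSg2 : Sg.card = 2 := by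
    have hSgT : Sg ⊆ F \ P := Finset.filter_subset _ _
    -- nonempty
    have hne : Sg.Nonempty := by
      obtain ⟨t, ht⟩ : (F \ P).Nonempty := by rw [← Finset.card_pos, hdiff]; omega
      rw [Finset.mem_sdiff] at ht
      rcases hout t ht.1 ht.2 with ⟨c, rfl, hca, hcb⟩ | ht2
      · exact ⟨{c}, (hSg_mem _).mpr ⟨c, rfl, ht.1, hca, hcb⟩⟩
      · obtain ⟨c, _, hcF, hcP⟩ := hpair_out t ht.1 ht.2 ht2
        rcases hout {c} hcF hcP with ⟨c', hc', hca, hcb⟩ | h2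
        · exact ⟨{c'}, (hSg_mem _).mpr ⟨c', rfl, hc' ▸ hcF, hca, hcb⟩⟩
        · simp at h2
    -- at most two: three outside singletons would all lie in the unique remaining outside member
    have hle : Sg.card ≤ 2 := by
      by_contra hgt
      push Not at hgt
      obtain ⟨S3, hS3, hS3c⟩ := Finset.exists_subset_card_eq (show 3 ≤ Sg.card by omega)
      obtain ⟨s1, s2, s3, h12, h13, h23, hS3eq⟩ := Finset.card_eq_three.mp hS3c
      have hs1 : s1 ∈ Sg := hS3 (by rw [hS3eq]; simp)
      have hs2 : s2 ∈ Sg := hS3 (by rw [hS3eq]; simp)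
      have hs3 : s3 ∈ Sg := hS3 (by rw [hS3eq]; simp)
      obtain ⟨c1, rfl, hc1F, hc1a, hc1b⟩ := (hSg_mem _).mp hs1
      obtain ⟨c2, rfl, hc2F, hc2a, hc2b⟩ := (hSg_mem _).mp hs2
      obtain ⟨c3, rfl, hc3F, hc3a, hc3b⟩ := (hSg_mem _).mp hs3
      -- the outside pairs containing c1, c2, c3 lie in (F \ P) \ S3, of size 1
      have hrest : ((F \ P) \ S3).card = 1 := by
        rw [Finset.card_sdiff_of_subset (hS3.trans hSgT), hdiff, hS3c]
      obtain ⟨y0, hy0⟩ := Finset.card_eq_one.mp hrest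
      have hin : ∀ c : Fin h, ({c} : Finset (Fin h)) ∈ F → c ≠ a → c ≠ b → c ∈ y0 := by
        intro c hcF hca hcb
        obtain ⟨y, hyF, hyP, hy2, hcy⟩ := hsing_out c hcF hca hcb
        have : y ∈ (F \ P) \ S3 := by
          rw [Finset.mem_sdiff, Finset.mem_sdiff]
          refine ⟨⟨hyF, hyP⟩, fun hyS => ?_⟩
          have := (hSg_mem _).mp (hS3 hyS)
          obtain ⟨c', hc', -, -, -⟩ := this
          rw [hc'] at hy2; simp at hy2
        rw [hy0, Finset.mem_singleton] at this
        rw [← this]; exact hcy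
      have hy0F : y0 ∈ F := by
        have : y0 ∈ (F \ P) \ S3 := by rw [hy0]; simp
        rw [Finset.mem_sdiff, Finset.mem_sdiff] at this
        exact this.1.1
      have h3 : ({c1, c2, c3} : Finset (Fin h)) ⊆ y0 := by
        intro e he
        simp only [Finset.mem_insert, Finset.mem_singleton] at he
        rcases he with rfl | rfl | rfl
        · exact hin _ hc1F hc1a hc1b
        · exact hin _ hc2F hc2a hc2b
        · exact hin _ hc3F hc3a hc3b
      have hc3 : ({c1, c2, c3} : Finset (Fin h)).card = 3 := by
        rw [Finset.card_eq_three]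
        exact ⟨c1, c2, c3, fun e => h12 (by rw [e]), fun e => h13 (by rw [e]),
          fun e => h23 (by rw [e]), rfl⟩
      have := Finset.card_le_card h3
      rw [hc3] at this
      have := hle2 y0 hy0F
      omega
    -- not exactly one: then every outside pair is `{a, c}` or `{b, c}`
    have hne1 : Sg.card ≠ 1 := by
      intro h1
      obtain ⟨s, hs⟩ := Finset.card_eq_one.mp h1
      obtain ⟨c, hsc, hcF, hca, hcb⟩ := (hSg_mem s).mp (by rw [hs]; simp)
      subst hsc
      -- every outsider other than {c} is a pair {x, c} with x ∈ {a, b}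
      have hothers : ∀ t, t ∈ F \ P → t ≠ {c} → t = {a, c} ∨ t = {b, c} := by
        intro t ht htc
        rw [Finset.mem_sdiff] at ht
        rcases hout t ht.1 ht.2 with ⟨c', rfl, hc'a, hc'b⟩ | ht2
        · exfalso
          have : ({c'} : Finset (Fin h)) ∈ Sg := (hSg_mem _).mpr ⟨c', rfl, ht.1, hc'a, hc'b⟩
          rw [hs, Finset.mem_singleton] at this
          exact htc this
        · obtain ⟨c', hc't, hc'F, hc'P⟩ := hpair_out t ht.1 ht.2 ht2
          have hc'c : c' = c := by
            rcases hout {c'} hc'F hc'P with ⟨c'', hc'', hc''a, hc''b⟩ | h2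
            · have : ({c''} : Finset (Fin h)) ∈ Sg :=
                (hSg_mem _).mpr ⟨c'', rfl, hc'' ▸ hc'F, hc''a, hc''b⟩
              rw [hs, Finset.mem_singleton] at this
              have e1 := Finset.singleton_injective hc''
              have e2 := Finset.singleton_injective this
              rw [e1, e2]
            · simp at h2
          subst hc'c
          -- the other element of t
          obtain ⟨x, hx⟩ := Finset.card_eq_one.mp
            (show (t.erase c').card = 1 by rw [Finset.card_erase_of_mem hc't, ht2])
          have hxt : x ∈ t.erase c' := by rw [hx]; simp
          obtain ⟨hxc, hxt'⟩ := Finset.mem_erase.mp hxt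
          have hteq : t = {x, c'} := by rw [← Finset.insert_erase hc't, hx, Finset.pair_comm]
          rcases helem t ht.1 x hxt' with rfl | rfl | ⟨hxF, hxP⟩
          · exact Or.inl hteq
          · exact Or.inr hteq
          · exfalso
            rcases hout {x} hxF hxP with ⟨x', hx', hx'a, hx'b⟩ | h2
            · have : ({x'} : Finset (Fin h)) ∈ Sg := (hSg_mem _).mpr ⟨x', rfl, hx' ▸ hxF, hx'a, hx'b⟩
              rw [hs, Finset.mem_singleton] at this
              exact hxc ((Finset.singleton_injective hx').trans (Finset.singleton_injective this))
            · simp at h2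
      have hsub : F \ P ⊆ {{c}, {a, c}, {b, c}} := by
        intro t ht
        simp only [Finset.mem_insert, Finset.mem_singleton]
        by_cases htc : t = {c}
        · exact Or.inl htc
        · rcases hothers t ht htc with e | e
          · exact Or.inr (Or.inl e)
          · exact Or.inr (Or.inr e)
      have := Finset.card_le_card hsub
      have h3 : ({{c}, {a, c}, {b, c}} : Finset (Finset (Fin h))).card ≤ 3 := Finset.card_le_three
      rw [hdiff] at this
      omega
    have := hne.card_pos
    omega
  -- the two outside singletons {c}, {d} and the two outside pairs y, z
  obtain ⟨sc, sd, hscd, hSgeq⟩ := Finset.card_eq_two.mp hSg2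
  obtain ⟨c, hsc, hcF, hca, hcb⟩ := (hSg_mem sc).mp (by rw [hSgeq]; simp)
  obtain ⟨d, hsd, hdF, hda, hdb⟩ := (hSg_mem sd).mp (by rw [hSgeq]; simp)
  subst hsc
  subst hsd
  have hcd : c ≠ d := fun e => hscd (by rw [e])
  have hPr2 : ((F \ P) \ Sg).card = 2 := by
    rw [Finset.card_sdiff_of_subset (Finset.filter_subset _ _), hdiff, hSg2]
  obtain ⟨y, z, hyz, hPreq⟩ := Finset.card_eq_two.mp hPr2
  have hyT : y ∈ (F \ P) \ Sg := by rw [hPreq]; simp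
  have hzT : z ∈ (F \ P) \ Sg := by rw [hPreq]; simp
  rw [Finset.mem_sdiff, Finset.mem_sdiff] at hyT hzT
  -- membership in F, read off
  have hmemF : ∀ t, t ∈ F → t = ∅ ∨ t = {a} ∨ t = {b} ∨ t = {a, b} ∨ t = {c} ∨ t = {d} ∨
      t = y ∨ t = z := by
    intro t ht
    by_cases htP : t ∈ P
    · rcases (hPmem t).mp htP with e | e | e | e
      · exact Or.inl e
      · exact Or.inr (Or.inl e)
      · exact Or.inr (Or.inr (Or.inl e))
      · exact Or.inr (Or.inr (Or.inr (Or.inl e)))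
    · by_cases htS : t ∈ Sg
      · rw [hSgeq, Finset.mem_insert, Finset.mem_singleton] at htS
        rcases htS with e | e
        · exact Or.inr (Or.inr (Or.inr (Or.inr (Or.inl e))))
        · exact Or.inr (Or.inr (Or.inr (Or.inr (Or.inr (Or.inl e)))))
      · have : t ∈ (F \ P) \ Sg := by
          rw [Finset.mem_sdiff, Finset.mem_sdiff]; exact ⟨⟨ht, htP⟩, htS⟩
        rw [hPreq, Finset.mem_insert, Finset.mem_singleton] at this
        rcases this with e | e
        · exact Or.inr (Or.inr (Or.inr (Or.inr (Or.inr (Or.inr (Or.inl e))))))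
        · exact Or.inr (Or.inr (Or.inr (Or.inr (Or.inr (Or.inr (Or.inr e))))))
  -- the outside pairs are pairs inside {a, b, c, d} containing c or d
  have houtS : ∀ e : Fin h, ({e} : Finset (Fin h)) ∈ F → ({e} : Finset (Fin h)) ∉ P → e = c ∨ e = d := by
    intro e heF heP
    have : ({e} : Finset (Fin h)) ∈ Sg := by
      rcases hout {e} heF heP with ⟨e', he', he'a, he'b⟩ | h2
      · exact (hSg_mem _).mpr ⟨e', he', he' ▸ heF, he'a, he'b⟩
      · simp at h2
    rw [hSgeq, Finset.mem_insert, Finset.mem_singleton] at this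
    rcases this with e1 | e1
    · exact Or.inl (Finset.singleton_injective e1)
    · exact Or.inr (Finset.singleton_injective e1)
  have hshape : ∀ t, t ∈ F → t ∉ P → t ∉ Sg → ∃ e f : Fin h, e ≠ f ∧ t = {e, f} ∧
      (e = c ∨ e = d) ∧ (f = a ∨ f = b ∨ f = c ∨ f = d) := by
    intro t htF htP htS
    have ht2 : t.card = 2 := by
      rcases hout t htF htP with ⟨e, rfl, hea, heb⟩ | h2
      · exact absurd ((hSg_mem _).mpr ⟨e, rfl, htF, hea, heb⟩) htS
      · exact h2
    obtain ⟨e, het, heF, heP⟩ := hpair_out t htF htP ht2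
    obtain ⟨f, hf⟩ := Finset.card_eq_one.mp
      (show (t.erase e).card = 1 by rw [Finset.card_erase_of_mem het, ht2])
    have hft : f ∈ t.erase e := by rw [hf]; simp
    obtain ⟨hfe, hft'⟩ := Finset.mem_erase.mp hft
    refine ⟨e, f, fun e' => hfe e'.symm, by rw [← Finset.insert_erase het, hf], houtS e heF heP, ?_⟩
    rcases helem t htF f hft' with h1 | h1 | ⟨hfF, hfP⟩
    · exact Or.inl h1
    · exact Or.inr (Or.inl h1)
    · rcases houtS f hfF hfP with h2 | h2
      · exact Or.inr (Or.inr (Or.inl h2))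
      · exact Or.inr (Or.inr (Or.inr h2))
  -- c and d lie in outside pairs
  have hcov : ∀ e : Fin h, ({e} : Finset (Fin h)) ∈ F → e ≠ a → e ≠ b → e ∈ y ∨ e ∈ z := by
    intro e heF hea heb
    obtain ⟨t, htF, htP, ht2, het⟩ := hsing_out e heF hea heb
    have htS : t ∉ Sg := by
      intro htS
      obtain ⟨c', hc', -, -, -⟩ := (hSg_mem _).mp htS
      rw [hc'] at ht2; simp at ht2
    have : t ∈ (F \ P) \ Sg := by
      rw [Finset.mem_sdiff, Finset.mem_sdiff]; exact ⟨⟨htF, htP⟩, htS⟩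
    rw [hPreq, Finset.mem_insert, Finset.mem_singleton] at this
    rcases this with rfl | rfl
    · exact Or.inl het
    · exact Or.inr het
  -- normal form of an outside pair through a given outside-singleton element
  have norm_pair : ∀ t, t ∈ F → t ∉ P → t ∉ Sg → ∀ e₀ ∈ t, ∃ g : Fin h, g ≠ e₀ ∧ t = {e₀, g} ∧
      (g = a ∨ g = b ∨ g = c ∨ g = d) := by
    intro t htF htP htS e₀ he₀
    obtain ⟨e, f, hef, hteq, he, hf⟩ := hshape t htF htP htS
    rw [hteq, Finset.mem_insert, Finset.mem_singleton] at he₀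
    rcases he₀ with rfl | rfl
    · exact ⟨f, hef.symm, hteq, hf⟩
    · refine ⟨e, hef, by rw [hteq, Finset.pair_comm], ?_⟩
      rcases he with h1 | h1
      · exact Or.inr (Or.inr (Or.inl h1))
      · exact Or.inr (Or.inr (Or.inr h1))
  refine ⟨a, b, c, d, y, z, hab, hca, hcb, hda, hdb, hcd, hyz, haF, hbF, hxF, hcF, hdF,
    hyT.1.1, hzT.1.1, hmemF, ?_, ?_, ?_⟩
  · intro t ht e₀ he₀
    rcases ht with rfl | rfl
    · exact norm_pair _ hyT.1.1 hyT.1.2 hyT.2 e₀ he₀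
    · exact norm_pair _ hzT.1.1 hzT.1.2 hzT.2 e₀ he₀
  · intro t ht
    rcases ht with rfl | rfl
    · exact hshape _ hyT.1.1 hyT.1.2 hyT.2
    · exact hshape _ hzT.1.1 hzT.1.2 hzT.2
  · intro e he
    rcases he with rfl | rfl
    · exact hcov _ hcF hca hcb
    · exact hcov _ hdF hda hdb

end Summit.ValiantsHypothesis.ValiantsHypothesis.Theorems.BarrierLever.FiniteCheck
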